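import Mathlib

/-!
# Powers of the rank statistic have bounded Fourier level (stub `stub_radialMonomial`)

Line `SketchIdeator3G2` (radial branch) for the crux `LevelGradedCohnUmans.SubgroupIdentityDesigns`
(`stmt-MatrixMultiplication-14079`).

For `j ≤ k` the `j`-th power of the rank statistic `g ↦ p^{-rk(g - 1)}` on `GL_m(𝔽_p)` is a
combination `Σ_M c_M ψ(tr(M g))` (`ψ = ZMod.stdAddChar`) over matrices `M` of rank `≤ k`
(Delsarte's bilinear-forms eigenfunctions).  With `N = g - 1`:
* kernel count: `#{v ∈ 𝔽_p^m : v N = 0} · p^{rk N} = p^m` (rank–nullity for `Nᵀ`), hence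
  `#{E ∈ M_{j×m}(𝔽_p) : E N = 0} = (#{v : v N = 0})^j` and `p^{-j·rk N} = p^{-jm} #{E : E N = 0}`;
* orthogonality on `M_{m×j}(𝔽_p)`: `Σ_C ψ(tr(C K)) = p^{jm} [K = 0]` for `K ∈ M_{j×m}(𝔽_p)`;
* assembling with `K = E N = E g - E`: `p^{-j·rk N} = p^{-2jm} Σ_E Σ_C ψ(-tr(C E)) ψ(tr((C E) g))`,
  and the modes `C E` have rank `≤ rank C ≤ j ≤ k`.
The coefficient table is `c M = Σ_E Σ_C [M = C E] p^{-2jm} ψ(-tr M)`.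
-/

-- single-conjunct summit: namespace repeats MatrixMultiplication (summit = sub-problem)
set_option linter.dupNamespace false

noncomputable section

open scoped BigOperators Classical

namespace Summit.MatrixMultiplication.MatrixMultiplication.Theorems.Witnessed

variable {p m : ℕ} [Fact p.Prime]

/-- An additive character turns finite sums into finite products. -/
private theorem radial_addChar_map_sum {A R : Type*} [AddCommMonoid A] [CommMonoid R]
    (ψ : AddChar A R) {ι : Type*} (s : Finset ι) (a : ι → A) :
    ψ (∑ i ∈ s, a i) = ∏ i ∈ s, ψ (a i) := by
  -- adapted from the sibling stub file `…StubColFix.lean`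
  induction s using Finset.induction_on with
  | empty => simp
  | insert i s hi ih =>
    rw [Finset.sum_insert hi, Finset.prod_insert hi, AddChar.map_add_eq_mul, ih]

/-- Orthogonality of `ψ = ZMod.stdAddChar` on `𝔽_p^n`: `Σ_ξ ψ(ξ ⬝ w) = p^n [w = 0]`. -/
private theorem radial_sum_stdAddChar_dotProduct {n : ℕ} (w : Fin n → ZMod p) :
    ∑ ξ : Fin n → ZMod p, ZMod.stdAddChar (ξ ⬝ᵥ w) =
      if w = 0 then (p : ℂ) ^ n else 0 := by
  -- adapted from the sibling stub file `…StubRowFix.lean`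
  split_ifs with hw
  · subst hw
    simp only [dotProduct_zero, AddChar.map_zero_eq_one, Finset.sum_const, Finset.card_univ,
      Fintype.card_pi, Finset.prod_const, ZMod.card, Fintype.card_fin, nsmul_eq_mul, mul_one,
      Nat.cast_pow]
  · obtain ⟨l, hl⟩ : ∃ l, w l ≠ 0 := Function.ne_iff.mp hw
    let L : (Fin n → ZMod p) →+ ZMod p :=
      { toFun := fun ξ => ξ ⬝ᵥ w
        map_zero' := zero_dotProduct w
        map_add' := fun x y => add_dotProduct x y w }
    let Ψ : AddChar (Fin n → ZMod p) ℂ := (ZMod.stdAddChar (N := p)).compAddMonoidHom L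
    have hΨ : Ψ ≠ 1 := by
      have h1 : (ZMod.stdAddChar (N := p)).mulShift (w l) ≠ 1 := ZMod.isPrimitive_stdAddChar p hl
      obtain ⟨s, hs⟩ := AddChar.ne_one_iff.1 h1
      refine AddChar.ne_one_iff.2 ⟨Pi.single l s, ?_⟩
      rw [AddChar.mulShift_apply] at hs
      simpa [Ψ, L, single_dotProduct, mul_comm] using hs
    simpa [Ψ, L] using AddChar.sum_eq_zero_of_ne_one hΨ

/-- Orthogonality of `ψ` on `M_{m×j}(𝔽_p)` against the trace pairing:
`Σ_{C ∈ M_{m×j}} ψ(tr(C K)) = (p^j)^m [K = 0]` for `K ∈ M_{j×m}(𝔽_p)`. -/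
private theorem radial_sum_stdAddChar_trace {j : ℕ} (K : Matrix (Fin j) (Fin m) (ZMod p)) :
    ∑ C : Fin m → Fin j → ZMod p, ZMod.stdAddChar (Matrix.trace (Matrix.of C * K)) =
      if K = 0 then ((p : ℂ) ^ j) ^ m else 0 := by
  -- `tr(C K) = Σ_a C_a ⬝ (Kᵀ)_a`, so `ψ(tr(C K))` is a product over the rows `C_a` of `C`
  have htr : ∀ C : Fin m → Fin j → ZMod p,
      Matrix.trace (Matrix.of C * K) = ∑ a : Fin m, C a ⬝ᵥ K.transpose a := fun C => rfl
  simp_rw [htr, radial_addChar_map_sum]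
  have hps : ∑ C : Fin m → Fin j → ZMod p, ∏ a : Fin m, ZMod.stdAddChar (C a ⬝ᵥ K.transpose a) =
      ∏ a : Fin m, ∑ w : Fin j → ZMod p, ZMod.stdAddChar (w ⬝ᵥ K.transpose a) :=
    (Fintype.prod_sum fun (a : Fin m) (w : Fin j → ZMod p) => ZMod.stdAddChar (w ⬝ᵥ K.transpose a)).symm
  rw [hps]
  simp_rw [radial_sum_stdAddChar_dotProduct]
  split_ifs with hK
  · have h0 : ∀ a : Fin m, K.transpose a = 0 := fun a => by rw [hK, Matrix.transpose_zero]; rfl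
    simp only [h0, if_true, Finset.prod_const, Finset.card_univ, Fintype.card_fin]
  · have hKt : K.transpose ≠ 0 := fun h => hK (by simpa using congrArg Matrix.transpose h)
    obtain ⟨a, ha⟩ := Function.ne_iff.mp hKt
    exact Finset.prod_eq_zero (Finset.mem_univ a) (if_neg ha)

/-- Kernel count (rank–nullity): `#{v ∈ 𝔽_p^m : v N = 0} · p^{rk N} = p^m`. -/
private theorem radial_kernel_count (N : Matrix (Fin m) (Fin m) (ZMod p)) :
    (∑ v : Fin m → ZMod p, if Matrix.vecMul v N = 0 then (1 : ℂ) else 0) * (p : ℂ) ^ N.rank =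
      (p : ℂ) ^ m := by
  -- the left kernel of `N` is the kernel of `Nᵀ.mulVecLin`
  set f := N.transpose.mulVecLin
  have hker : ∀ v : Fin m → ZMod p,
      v ∈ Finset.univ.filter (fun v : Fin m → ZMod p => Matrix.vecMul v N = 0) ↔
        v ∈ LinearMap.ker f := by
    intro v
    rw [Finset.mem_filter, LinearMap.mem_ker, Matrix.mulVecLin_apply, Matrix.mulVec_transpose]
    exact ⟨fun h => h.2, fun h => ⟨Finset.mem_univ _, h⟩⟩
  have hsum : (∑ v : Fin m → ZMod p, if Matrix.vecMul v N = 0 then (1 : ℂ) else 0) =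
      (Nat.card (LinearMap.ker f) : ℂ) := by
    rw [Finset.sum_boole, ← Nat.subtype_card _ hker]
  have hcard : Nat.card (LinearMap.ker f) = p ^ Module.finrank (ZMod p) (LinearMap.ker f) := by
    rw [Module.natCard_eq_pow_finrank (K := ZMod p), Nat.card_zmod]
  have hrank : Module.finrank (ZMod p) (LinearMap.range f) = N.rank := by
    rw [← Matrix.rank_transpose N]
    rfl
  have hdim : Module.finrank (ZMod p) (LinearMap.range f) +
      Module.finrank (ZMod p) (LinearMap.ker f) = m := by
    rw [LinearMap.finrank_range_add_finrank_ker, Module.finrank_fin_fun]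
  rw [hsum, hcard, Nat.cast_pow, ← hrank, ← pow_add, add_comm, hdim]

/-- Matrix kernel count: `E N = 0` iff every row of `E` is in the left kernel of `N`, so
`#{E ∈ M_{j×m}(𝔽_p) : E N = 0} = (#{v : v N = 0})^j`. -/
private theorem radial_matrix_kernel_count {j : ℕ} (N : Matrix (Fin m) (Fin m) (ZMod p)) :
    ∑ E : Fin j → Fin m → ZMod p, (if Matrix.of E * N = 0 then (1 : ℂ) else 0) =
      (∑ v : Fin m → ZMod p, if Matrix.vecMul v N = 0 then (1 : ℂ) else 0) ^ j := by
  rw [Fintype.sum_pow]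
  refine Finset.sum_congr rfl fun E _ => ?_
  by_cases h : Matrix.of E * N = 0
  · rw [if_pos h]
    refine (Finset.prod_eq_one fun i _ => if_pos ?_).symm
    show (Matrix.of E * N) i = 0
    rw [h]
    rfl
  · rw [if_neg h]
    obtain ⟨i, hi⟩ : ∃ i : Fin j, Matrix.vecMul (E i) N ≠ 0 := by
      by_contra hc
      push Not at hc
      exact h (Matrix.ext fun i a => congr_fun (hc i) a)
    exact (Finset.prod_eq_zero (Finset.mem_univ i) (if_neg hi)).symm

/-- The exponent bookkeeping: from `S · P^r = P^n` (so `r ≤ n` implicitly) we get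
`(P⁻¹)^{r j} = P^{-n j} P^{-n j} (P^j)^n S^j`. -/
private theorem radial_pow_identity {P S : ℂ} {r n j : ℕ} (hP : P ≠ 0)
    (hS : S * P ^ r = P ^ n) :
    (P⁻¹ ^ r) ^ j = P⁻¹ ^ (n * j) * P⁻¹ ^ (n * j) * ((P ^ j) ^ n * S ^ j) := by
  have hS' : S = P ^ n * P⁻¹ ^ r := by
    rw [← hS, inv_pow, mul_inv_cancel_right₀ (pow_ne_zero r hP)]
  have h1 : P⁻¹ ^ (n * j) * P ^ (n * j) = 1 := by
    rw [← mul_pow, inv_mul_cancel₀ hP, one_pow]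
  rw [hS']
  calc (P⁻¹ ^ r) ^ j = (P⁻¹ ^ (n * j) * P ^ (n * j)) * (P⁻¹ ^ (n * j) * P ^ (n * j)) *
      (P⁻¹ ^ r) ^ j := by rw [h1, one_mul, one_mul]
    _ = P⁻¹ ^ (n * j) * P⁻¹ ^ (n * j) * ((P ^ j) ^ n * (P ^ n * P⁻¹ ^ r) ^ j) := by ring

/-- **Powers of the rank statistic** (stub `stub_radialMonomial`).  For `j ≤ k` the function
`g ↦ (p^{-rk(g-1)})^j` on `GL_m(𝔽_p)` has Fourier level `≤ k`: it equals `Σ_M c_M ψ(tr(M g))`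
(`ψ = ZMod.stdAddChar`) with `c` supported on matrices of rank `≤ k`.  Indeed
`p^{-j·rk(g-1)} = p^{-jm} · #{E ∈ M_{j×m}(𝔽_p) : E (g-1) = 0}` and
`[E (g-1) = 0] = p^{-jm} Σ_{C ∈ M_{m×j}} ψ(tr(C E g)) ψ(-tr(C E))`, whose modes `C E` have rank `≤ j`
(Delsarte's bilinear-forms eigenfunctions). -/
theorem stub_radialMonomial {k j : ℕ} (hj : j ≤ k) :
    ∃ c : Matrix (Fin m) (Fin m) (ZMod p) → ℂ, (∀ M, k < M.rank → c M = 0) ∧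
      ∀ g : Matrix.GeneralLinearGroup (Fin m) (ZMod p),
        (((p : ℂ)⁻¹) ^ ((g : Matrix (Fin m) (Fin m) (ZMod p)) - 1).rank) ^ j =
          ∑ M : Matrix (Fin m) (Fin m) (ZMod p),
            c M * ZMod.stdAddChar (Matrix.trace (M * (g : Matrix (Fin m) (Fin m) (ZMod p)))) := by
  refine ⟨fun M => ∑ E : Fin j → Fin m → ZMod p, ∑ C : Fin m → Fin j → ZMod p,
      (if M = Matrix.of C * Matrix.of E then
        ((p : ℂ)⁻¹) ^ (m * j) * ((p : ℂ)⁻¹) ^ (m * j) * ZMod.stdAddChar (-Matrix.trace M)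
      else 0), fun M hM => ?_, fun g => ?_⟩
  · -- support: the modes `C E` have rank `≤ rank C ≤ j ≤ k`
    refine Finset.sum_eq_zero fun E _ => Finset.sum_eq_zero fun C _ => if_neg ?_
    rintro rfl
    exact absurd (((Matrix.rank_mul_le_left _ _).trans (Matrix.rank_le_width (Matrix.of C))).trans
      hj) (not_le.mpr hM)
  · set G : Matrix (Fin m) (Fin m) (ZMod p) := (g : Matrix (Fin m) (Fin m) (ZMod p))
    -- Step 1: collapse the right-hand side onto the modes `C E` and recombine the characters,
    -- `ψ(-tr(C E)) ψ(tr(C E G)) = ψ(tr(C (E (G - 1))))`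
    have hR : (∑ M : Matrix (Fin m) (Fin m) (ZMod p),
        (∑ E : Fin j → Fin m → ZMod p, ∑ C : Fin m → Fin j → ZMod p,
          (if M = Matrix.of C * Matrix.of E then
            ((p : ℂ)⁻¹) ^ (m * j) * ((p : ℂ)⁻¹) ^ (m * j) * ZMod.stdAddChar (-Matrix.trace M)
          else 0)) * ZMod.stdAddChar (Matrix.trace (M * G))) =
        ((p : ℂ)⁻¹) ^ (m * j) * ((p : ℂ)⁻¹) ^ (m * j) *
          ∑ E : Fin j → Fin m → ZMod p, ∑ C : Fin m → Fin j → ZMod p,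
            ZMod.stdAddChar (Matrix.trace (Matrix.of C * (Matrix.of E * (G - 1)))) := by
      calc (∑ M : Matrix (Fin m) (Fin m) (ZMod p),
            (∑ E : Fin j → Fin m → ZMod p, ∑ C : Fin m → Fin j → ZMod p,
              (if M = Matrix.of C * Matrix.of E then
                ((p : ℂ)⁻¹) ^ (m * j) * ((p : ℂ)⁻¹) ^ (m * j) * ZMod.stdAddChar (-Matrix.trace M)
              else 0)) * ZMod.stdAddChar (Matrix.trace (M * G)))
          = ∑ M : Matrix (Fin m) (Fin m) (ZMod p), ∑ E : Fin j → Fin m → ZMod p,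
              ∑ C : Fin m → Fin j → ZMod p, (if M = Matrix.of C * Matrix.of E then
                ((p : ℂ)⁻¹) ^ (m * j) * ((p : ℂ)⁻¹) ^ (m * j) *
                  (ZMod.stdAddChar (-Matrix.trace M) * ZMod.stdAddChar (Matrix.trace (M * G)))
                else 0) := by
            refine Finset.sum_congr rfl fun M _ => ?_
            rw [Finset.sum_mul]
            refine Finset.sum_congr rfl fun E _ => ?_
            rw [Finset.sum_mul]
            refine Finset.sum_congr rfl fun C _ => ?_
            rw [ite_mul, zero_mul, mul_assoc]
        _ = ∑ E : Fin j → Fin m → ZMod p, ∑ C : Fin m → Fin j → ZMod p,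
              ((p : ℂ)⁻¹) ^ (m * j) * ((p : ℂ)⁻¹) ^ (m * j) *
                (ZMod.stdAddChar (-Matrix.trace (Matrix.of C * Matrix.of E)) *
                  ZMod.stdAddChar (Matrix.trace (Matrix.of C * Matrix.of E * G))) := by
            rw [Finset.sum_comm]
            refine Finset.sum_congr rfl fun E _ => ?_
            rw [Finset.sum_comm]
            refine Finset.sum_congr rfl fun C _ => ?_
            rw [Fintype.sum_ite_eq']
        _ = ((p : ℂ)⁻¹) ^ (m * j) * ((p : ℂ)⁻¹) ^ (m * j) *
              ∑ E : Fin j → Fin m → ZMod p, ∑ C : Fin m → Fin j → ZMod p,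
                ZMod.stdAddChar (Matrix.trace (Matrix.of C * (Matrix.of E * (G - 1)))) := by
            rw [Finset.mul_sum]
            refine Finset.sum_congr rfl fun E _ => ?_
            rw [Finset.mul_sum]
            refine Finset.sum_congr rfl fun C _ => ?_
            rw [← AddChar.map_add_eq_mul, Matrix.mul_sub, Matrix.mul_one, Matrix.mul_sub,
              Matrix.trace_sub, ← Matrix.mul_assoc, sub_eq_neg_add]
    -- Step 2: orthogonality in `C`, then the kernel count in `E`
    have hO : (∑ E : Fin j → Fin m → ZMod p, ∑ C : Fin m → Fin j → ZMod p,
        ZMod.stdAddChar (Matrix.trace (Matrix.of C * (Matrix.of E * (G - 1))))) =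
        ((p : ℂ) ^ j) ^ m *
          (∑ v : Fin m → ZMod p, if Matrix.vecMul v (G - 1) = 0 then (1 : ℂ) else 0) ^ j := by
      rw [← radial_matrix_kernel_count, Finset.mul_sum]
      refine Finset.sum_congr rfl fun E _ => ?_
      rw [radial_sum_stdAddChar_trace, mul_boole]
    -- Step 3: the exponent bookkeeping, `#{v : v (G - 1) = 0} · p^{rk(G - 1)} = p^m`
    rw [hR, hO]
    exact radial_pow_identity (Nat.cast_ne_zero.mpr (Fact.out : p.Prime).ne_zero)
      (radial_kernel_count (G - 1))

end Summit.MatrixMultiplication.MatrixMultiplication.Theorems.Witnessed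

end
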